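import Literature.AlgebraicGeometry.Resolution.NeronPopescuDesingularization
import Mathlib.RingTheory.Smooth.Locus
import Mathlib.RingTheory.MvPolynomial.Localization
import Mathlib.RingTheory.Localization.Away.Basic
import Mathlib.RingTheory.FinitePresentation
import HarnessLib

/-!
# The singular ideal `H_{A/R}` and the "final solve" step of Popescu's theorem (Stacks 07C5, 07EU)

Topic: `Literature/AlgebraicGeometry/Resolution`. First file of the DECOMPOSITION of the named
fact `Popescu1986_generalNeronDesingularization` (Popescu 1986, Thm. (2.5) (i) ⇒ (ii) = Stacks,
Tag 07GC, *Smoothing Ring Maps*, Thm. 12.1) along the printed proof of Stacks 07GC. That proof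
is a Noetherian induction on the ideal `𝔥_A = √(H_{A/R} Λ) ⊆ Λ` attached to a factorisation
`R → A → Λ` (`A` of finite presentation), where `H_{A/R} ⊆ A` is the **singular ideal** of `A`
over `R` (Stacks 07C5; Popescu 1986, p. 88: `H_{B/A}`, "`V(H_{B/A})` is exactly the nonsmooth
locus of `B` over `A`"); its base case is Stacks, Lemma 07EU ("final solve"): if
`H_{A/R} Λ = Λ` then `A → Λ` factors through a smooth `R`-algebra. This file

* DEFINES `singularIdeal R A` (= `H_{A/R}`) from Mathlib's smooth locus `Algebra.smoothLocus`
  (the vanishing ideal of its complement) and proves its defining properties for `A` of finite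
  presentation over `R`: `mem_singularIdeal_iff_smooth` (`a ∈ H_{A/R} ↔ A_a` smooth over `R`,
  Stacks 07C4/07C5; Popescu p. 88), `zeroLocus_singularIdeal` (`V(H_{A/R})` = the non-smooth
  locus), `isRadical_singularIdeal`, `singularIdeal_eq_top_iff` ("`B` is smooth over `A` iff
  `H_{B/A} = B`", Popescu p. 88);
* DEFINES the bookkeeping notions of the proof of 07GC: `FactorsThroughSmooth R φ` (the
  conclusion of Popescu's theorem for one `φ : A →ₐ[R] Λ`: "the couple `(A, φ)` has a
  desingularization", Popescu p. 88, with `C` merely smooth as in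
  `Popescu1986_generalNeronDesingularization`), `HasSmoothFactorizations R Λ` ("PT holds for
  `R → Λ`", Stacks, text after Situation 07F2, in the factorisation form of Algebra, Lemma 07C3
  (2)), `hIdeal R φ` (`𝔥_A`, Stacks, Situation 07F7) and `CanResolve R φ 𝔮` ("`R → A → Λ ⊃ 𝔮`
  can be resolved", Stacks, text after 07F7);
* PROVES Stacks, Lemma 07EU (`factorsThroughSmooth_of_map_singularIdeal_eq_top`): if
  `H_{A/R} Λ = Λ` then `A → Λ` factors through a smooth `R`-algebra. The printed proof takes
  `B = A[x_1, …, x_r]/(∑ f_i x_i - 1)`; we take instead the isomorphic-in-spirit localisation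
  `B = A[x_1, …, x_r][1/∑ f_i x_i]`, which is smooth over `R` because `∑ f_i x_i` lies in the
  singular ideal of `A[x_1, …, x_r]` over `R` (on `D(f_i)` the algebra `A[x][1/f_i] = A_{f_i}[x]`
  is smooth), so that smoothness is read off `mem_singularIdeal_iff_smooth` with no gluing.

The remaining steps of the proof of 07GC (reduction to a base field 07F5, the resolution lemmas
07FE/07FJ, the Noetherian induction and the assembly of
`Popescu1986_generalNeronDesingularization`) are in `NeronPopescuSteps.lean`.

## Rendering notes

* Stacks defines `H_{A/R}` as the radical ideal cutting out `{𝔮 | R → A not smooth at 𝔮}` with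
  "smooth at `𝔮`" = some `A_g`, `g ∉ 𝔮`, is smooth over `R` (Algebra, Def. 00TB). Mathlib's
  `Algebra.smoothLocus R A = {𝔮 | A_𝔮 formally smooth over R}` agrees with the Stacks smooth
  locus when `A` is of finite presentation over `R` (Mathlib's
  `Algebra.basicOpen_subset_smoothLocus_iff_smooth`, `Algebra.IsSmoothAt.exists_notMem_smooth`),
  which is the only case in which `H_{A/R}` is used in the proof of 07GC (Situation 07F7: `A`
  of finite presentation). We therefore define `singularIdeal R A` as the vanishing ideal of the
  complement of `Algebra.smoothLocus R A`; for `A` of finite presentation this is literally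
  Stacks' `H_{A/R}` (`zeroLocus_singularIdeal`, `isRadical_singularIdeal`). Elkik's description
  of `H_{A/R}` by strictly standard elements (Stacks 07CA; Popescu's `H_f(y)`, p. 87) is a
  theorem about this ideal, not used here.
* "PT holds for `R → Λ`" is, in Stacks, "`Λ` is a filtered colimit of smooth `R`-algebras"; by
  Algebra, Lemma 07C3 this is equivalent to the factorisation property (2) for finitely
  presented `A`, which is how PT is USED throughout the chapter ("We have to find a factorization
  `A → B → Λ` with `B` smooth over `R`, see Algebra, Lemma 07C3", proof of 07F5) and how
  `Popescu1986_generalNeronDesingularization` is stated. Over a Noetherian `R` (Situation 07F2)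
  finite type = finite presentation, and we quantify over finite type `A` to match the target.
* Universes: one universe `u` for all rings, as in the target fact.

## Sources

* The Stacks Project, *Smoothing Ring Maps* (Tag 07BW): Def. 07C5 (singular ideal), Lemma 07EU
  (final solve), Situation 07F2 and the definition of PT, Situation 07F7 and the definition of
  "can be resolved", Thm. 07GC; *Algebra*, Def. 00TB, Lemma 07C3. [StacksProject]
* D. Popescu, *General Néron desingularization and approximation*, Nagoya Math. J. 104 (1986),
  §2, pp. 87–89 (`H_{B/A}`, desingularization of a couple `(B, f)`, Thm. (2.5)). [Popescu1986]
-/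

noncomputable section

open MvPolynomial

namespace Literature.AlgebraicGeometry.Resolution

universe u

/-! ## The singular ideal -/

section SingularIdeal

variable (R A : Type u) [CommRing R] [CommRing A] [Algebra R A]

/-- The **singular ideal** `H_{A/R} ⊆ A` of an `R`-algebra `A` (Stacks 07C5; Popescu's
`H_{B/A}`, p. 88): the radical ideal of `A` cutting out the non-smooth locus of
`Spec A → Spec R`, i.e. the vanishing ideal of the complement of the smooth locus
`Algebra.smoothLocus R A`. [cite: StacksProject, Tag 07C5] -/
def singularIdeal : Ideal A :=
  PrimeSpectrum.vanishingIdeal (Algebra.smoothLocus R A)ᶜ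

variable {R A}

/-- Membership in the singular ideal: `a ∈ H_{A/R}` iff every prime not containing `a` is in
the smooth locus, i.e. `D(a) ⊆` smooth locus. [folklore] -/
theorem mem_singularIdeal_iff {a : A} :
    a ∈ singularIdeal R A ↔ ∀ x : PrimeSpectrum A, a ∉ x.asIdeal → x ∈ Algebra.smoothLocus R A := by
  simp only [singularIdeal, PrimeSpectrum.mem_vanishingIdeal, Set.mem_compl_iff]
  exact ⟨fun h x hx => by_contra fun hx' => hx (h x hx'),
    fun h x hx => by_contra fun hax => hx (h x hax)⟩

/-- `a ∈ H_{A/R}` iff the basic open `D(a)` is contained in the smooth locus. [folklore] -/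
theorem mem_singularIdeal_iff_basicOpen_subset {a : A} :
    a ∈ singularIdeal R A ↔
      (↑(PrimeSpectrum.basicOpen a) : Set (PrimeSpectrum A)) ⊆ Algebra.smoothLocus R A := by
  rw [mem_singularIdeal_iff]
  exact ⟨fun h x hx => h x ((PrimeSpectrum.mem_basicOpen _ _).mp hx),
    fun h x hx => h ((PrimeSpectrum.mem_basicOpen _ _).mpr hx)⟩

/-- **Stacks 07C4/07C5; Popescu p. 88**: for `A` of finite presentation over `R`,
`a ∈ H_{A/R}` iff `A_a` is smooth over `R`. [cite: StacksProject, Tag 07C5] -/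
theorem mem_singularIdeal_iff_smooth [Algebra.FinitePresentation R A] {a : A} :
    a ∈ singularIdeal R A ↔ Algebra.Smooth R (Localization.Away a) :=
  mem_singularIdeal_iff_basicOpen_subset.trans Algebra.basicOpen_subset_smoothLocus_iff_smooth

/-- The singular ideal is a radical ideal. [cite: StacksProject, Tag 07C5] -/
theorem isRadical_singularIdeal : (singularIdeal R A).IsRadical :=
  PrimeSpectrum.isRadical_vanishingIdeal _

/-- **Stacks 07C5**, defining property: for `A` of finite presentation over `R`,
`V(H_{A/R})` is exactly the set of primes at which `R → A` is not smooth.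
[cite: StacksProject, Tag 07C5] -/
theorem zeroLocus_singularIdeal [Algebra.FinitePresentation R A] :
    PrimeSpectrum.zeroLocus (singularIdeal R A : Set A) = (Algebra.smoothLocus R A)ᶜ := by
  rw [singularIdeal, PrimeSpectrum.zeroLocus_vanishingIdeal_eq_closure,
    (Algebra.isOpen_smoothLocus (R := R) (A := A)).isClosed_compl.closure_eq]

/-- **Popescu p. 88** ("`B` is smooth over `A` iff `H_{B/A} = B`"), for `A` of finite
presentation over `R`. [cite: Popescu1986, §2 p. 88] -/
theorem singularIdeal_eq_top_iff [Algebra.FinitePresentation R A] :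
    singularIdeal R A = ⊤ ↔ Algebra.Smooth R A := by
  constructor
  · intro h
    have h1 : (1 : A) ∈ singularIdeal R A := h ▸ Submodule.mem_top
    have huniv : Algebra.smoothLocus R A = Set.univ :=
      Set.eq_univ_of_forall fun x =>
        mem_singularIdeal_iff.mp h1 x ((Ideal.ne_top_iff_one _).mp x.2.ne_top)
    haveI : Algebra.FormallySmooth R A := Algebra.smoothLocus_eq_univ_iff.mp huniv
    exact ⟨inferInstance, inferInstance⟩
  · intro h
    refine (Ideal.eq_top_iff_one _).mpr (mem_singularIdeal_iff.mpr fun x _ => ?_)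
    rw [Algebra.smoothLocus_eq_univ]
    exact Set.mem_univ x

/-- A smooth algebra has unit singular ideal (no finite presentation hypothesis needed in this
direction: the smooth locus is everything). [folklore] -/
theorem singularIdeal_eq_top_of_smooth [Algebra.Smooth R A] : singularIdeal R A = ⊤ := by
  refine (Ideal.eq_top_iff_one _).mpr (mem_singularIdeal_iff.mpr fun x _ => ?_)
  rw [Algebra.smoothLocus_eq_univ]
  exact Set.mem_univ x

end SingularIdeal

/-! ## Factorisations through smooth algebras; `𝔥_A`; resolutions -/

section Notions

variable (R : Type u) {A Λ : Type u} [CommRing R] [CommRing A] [Algebra R A] [CommRing Λ]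
  [Algebra R Λ]

/-- `φ : A → Λ` **factors through a smooth `R`-algebra**: there are a smooth `R`-algebra `C`
and `R`-algebra maps `v : A → C`, `w : C → Λ` with `w ∘ v = φ` (Popescu p. 88: "the couple
`(B, f)` has a desingularization", with `B'` merely smooth; the conclusion of
`Popescu1986_generalNeronDesingularization`). [cite: Popescu1986, §2 p. 88] -/
def FactorsThroughSmooth (φ : A →ₐ[R] Λ) : Prop :=
  ∃ (C : Type u) (_ : CommRing C) (_ : Algebra R C),
    Algebra.Smooth R C ∧ ∃ (v : A →ₐ[R] C) (w : C →ₐ[R] Λ), w.comp v = φ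

/-- **"PT holds for `R → Λ`"** (Stacks, text after Situation 07F2: "`Λ` is a filtered colimit
of smooth `R`-algebras"), in the equivalent factorisation form of Algebra, Lemma 07C3 (2):
every `R`-algebra map `A → Λ` from a finite type `R`-algebra `A` factors through a smooth
`R`-algebra. [cite: StacksProject, Tag 07F2] -/
def HasSmoothFactorizations (Λ : Type u) [CommRing Λ] [Algebra R Λ] : Prop :=
  ∀ (A : Type u) [CommRing A] [Algebra R A], Algebra.FiniteType R A →
    ∀ φ : A →ₐ[R] Λ, FactorsThroughSmooth R φ

/-- The ideal **`𝔥_A = √(H_{A/R} Λ) ⊆ Λ`** of a factorisation `R → A → Λ` (Stacks, Situation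
07F7; Popescu's `𝔞_f = √(f(H_{B/A})A')`, Cor. (2.4)). [cite: StacksProject, Tag 07F7] -/
def hIdeal (φ : A →ₐ[R] Λ) : Ideal Λ :=
  ((singularIdeal R A).map φ).radical

/-- **"`R → A → Λ ⊃ 𝔮` can be resolved"** (Stacks, text following Situation 07F7): there is a
factorisation `A → B → Λ` of `φ` with `B` of finite presentation over `R` and
`𝔥_A ⊆ 𝔥_B ⊄ 𝔮`. [cite: StacksProject, Tag 07F7] -/
def CanResolve (φ : A →ₐ[R] Λ) (q : Ideal Λ) : Prop :=
  ∃ (B : Type u) (_ : CommRing B) (_ : Algebra R B), Algebra.FinitePresentation R B ∧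
    ∃ (v : A →ₐ[R] B) (w : B →ₐ[R] Λ), w.comp v = φ ∧ hIdeal R φ ≤ hIdeal R w ∧ ¬ hIdeal R w ≤ q

variable {R}

/-- Unfolding lemma for `hIdeal`. [folklore] -/
theorem mem_hIdeal_iff (φ : A →ₐ[R] Λ) (x : Λ) :
    x ∈ hIdeal R φ ↔ ∃ n : ℕ, x ^ n ∈ (singularIdeal R A).map φ :=
  Iff.rfl

/-- `𝔥_A = Λ` iff `H_{A/R} Λ = Λ`. [folklore] -/
theorem hIdeal_eq_top_iff (φ : A →ₐ[R] Λ) :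
    hIdeal R φ = ⊤ ↔ (singularIdeal R A).map φ = ⊤ :=
  Ideal.radical_eq_top

/-- If `φ` factors as `w ∘ v` through a smooth `C` and `w` factors through a smooth algebra,
then so does `φ` — trivially, but this is the shape in which the Noetherian induction of 07GC
consumes a resolution. [folklore] -/
theorem FactorsThroughSmooth.of_comp {B : Type u} [CommRing B] [Algebra R B] {φ : A →ₐ[R] Λ}
    (v : A →ₐ[R] B) {w : B →ₐ[R] Λ} (hw : FactorsThroughSmooth R w) (h : w.comp v = φ) :
    FactorsThroughSmooth R φ := by
  obtain ⟨C, _, _, hC, v', w', hw'⟩ := hw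
  exact ⟨C, inferInstance, inferInstance, hC, v'.comp v, w', by rw [← AlgHom.comp_assoc, hw', h]⟩

/-- A smooth `A` needs no desingularisation: `φ` factors through `A` itself. [folklore] -/
theorem factorsThroughSmooth_of_smooth [Algebra.Smooth R A] (φ : A →ₐ[R] Λ) :
    FactorsThroughSmooth R φ :=
  ⟨A, inferInstance, inferInstance, ‹_›, AlgHom.id R A, φ, AlgHom.comp_id φ⟩

end Notions

/-! ## Stacks 07EU: the final solve -/

section FinalSolve

/-- If `A_a` is smooth over `R` then so is `A[x_1, …, x_n][1/a] ≅ A_a[x_1, …, x_n]`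
(polynomial rings over smooth algebras are smooth; `MvPolynomial.isLocalization` identifies the
two sides). [folklore] -/
theorem smooth_localization_away_C {R A : Type u} [CommRing R] [CommRing A] [Algebra R A]
    (n : ℕ) (a : A) (h : Algebra.Smooth R (Localization.Away a)) :
    Algebra.Smooth R (Localization.Away (C a : MvPolynomial (Fin n) A)) := by
  set Aa := Localization.Away a
  letI : Algebra (MvPolynomial (Fin n) A) (MvPolynomial (Fin n) Aa) :=
    MvPolynomial.algebraMvPolynomial
  haveI : Algebra.Smooth R Aa := h
  haveI : Algebra.Smooth Aa (MvPolynomial (Fin n) Aa) := ⟨inferInstance, inferInstance⟩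
  haveI : Algebra.Smooth R (MvPolynomial (Fin n) Aa) := Algebra.Smooth.comp R Aa _
  have hmap : (Submonoid.powers a).map (C : A →+* MvPolynomial (Fin n) A) =
      Submonoid.powers (C a) := Submonoid.map_powers _ _
  haveI : IsLocalization.Away (C a : MvPolynomial (Fin n) A) (MvPolynomial (Fin n) Aa) := by
    rw [IsLocalization.Away, ← hmap]
    exact MvPolynomial.isLocalization (Submonoid.powers a) Aa
  haveI : IsScalarTower R (MvPolynomial (Fin n) A) (MvPolynomial (Fin n) Aa) :=
    IsScalarTower.of_algebraMap_eq fun r => by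
      rw [MvPolynomial.algebraMap_def, MvPolynomial.algebraMap_apply, MvPolynomial.algebraMap_apply,
        MvPolynomial.map_C, ← IsScalarTower.algebraMap_apply]
  let e : Localization.Away (C a : MvPolynomial (Fin n) A) ≃ₐ[MvPolynomial (Fin n) A]
      MvPolynomial (Fin n) Aa :=
    IsLocalization.algEquiv (Submonoid.powers (C a)) _ _
  exact Algebra.Smooth.of_equiv (e.restrictScalars R).symm

/-- **Stacks, Lemma 07EU** ("final solve"), PROVED: let `R → A → Λ` be ring maps with `A` of
finite presentation over `R` and `H_{A/R} Λ = Λ`; then `A → Λ` factors through a smooth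
`R`-algebra. Proof: write `1 = ∑ f_i λ_i` with `f_i ∈ H_{A/R}`; the element `t = ∑ f_i x_i` of
`A[x_1, …, x_r]` lies in the singular ideal of `A[x]` over `R` (a prime not containing `t`
misses some `f_i`, and `A[x][1/f_i] = A_{f_i}[x]` is smooth over `R`), so `B = A[x][1/t]` is
smooth over `R`, and `x_i ↦ λ_i` defines `B → Λ` since `t ↦ 1`. (Stacks takes the quotient
`A[x]/(t - 1)` instead; Popescu uses this step as the base of the induction proving Cor. (2.4).)
[cite: StacksProject, Tag 07EU] -/
theorem factorsThroughSmooth_of_map_singularIdeal_eq_top {R A Λ : Type u} [CommRing R]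
    [CommRing A] [Algebra R A] [Algebra.FinitePresentation R A] [CommRing Λ] [Algebra R Λ]
    (φ : A →ₐ[R] Λ) (h : (singularIdeal R A).map φ = ⊤) : FactorsThroughSmooth R φ := by
  classical
  have h1 : (1 : Λ) ∈ (singularIdeal R A).map φ := h ▸ Submodule.mem_top
  obtain ⟨n, lam, g, hsum⟩ := Submodule.mem_span_set'.mp h1
  have hg : ∀ i, ∃ a ∈ singularIdeal R A, φ a = (g i : Λ) := fun i => (g i).2
  choose a ha hφa using hg
  -- the element `t = ∑ a_i x_i` of the polynomial ring `A[x_1, …, x_n]`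
  set t : MvPolynomial (Fin n) A := ∑ i, C (a i) * X i with ht_def
  have hCa : ∀ i, (C (a i) : MvPolynomial (Fin n) A) ∈ singularIdeal R (MvPolynomial (Fin n) A) :=
    fun i => mem_singularIdeal_iff_smooth.mpr
      (smooth_localization_away_C n (a i) (mem_singularIdeal_iff_smooth.mp (ha i)))
  have ht : t ∈ singularIdeal R (MvPolynomial (Fin n) A) := by
    rw [mem_singularIdeal_iff]
    intro x hx
    have hex : ∃ i, (C (a i) : MvPolynomial (Fin n) A) ∉ x.asIdeal := by
      by_contra hall
      refine hx ?_
      rw [ht_def]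
      refine Ideal.sum_mem _ fun i _ => Ideal.mul_mem_right _ _ ?_
      by_contra hi
      exact hall ⟨i, hi⟩
    obtain ⟨i, hi⟩ := hex
    exact mem_singularIdeal_iff.mp (hCa i) x hi
  have hsmooth : Algebra.Smooth R (Localization.Away t) := mem_singularIdeal_iff_smooth.mp ht
  -- the maps `ψ : A[x] → Λ`, `x_i ↦ λ_i`, with `ψ t = 1`, and its extension `w` to `A[x][1/t]`
  set ψ : MvPolynomial (Fin n) A →ₐ[R] Λ := aevalTower φ lam with hψ_def
  have hψt : ψ t = 1 := by
    rw [ht_def, map_sum, ← hsum]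
    refine Finset.sum_congr rfl fun i _ => ?_
    rw [map_mul, hψ_def, aevalTower_C, aevalTower_X, hφa, smul_eq_mul, mul_comm]
  have hunit : ∀ y : Submonoid.powers t, IsUnit (ψ y) := by
    rintro ⟨y, k, rfl⟩
    rw [map_pow, hψt, one_pow]
    exact isUnit_one
  set w : Localization.Away t →ₐ[R] Λ := IsLocalization.liftAlgHom hunit with hw_def
  let v : A →ₐ[R] Localization.Away t :=
    (IsScalarTower.toAlgHom R (MvPolynomial (Fin n) A) (Localization.Away t)).comp
      (IsScalarTower.toAlgHom R A (MvPolynomial (Fin n) A))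
  refine ⟨Localization.Away t, inferInstance, inferInstance, hsmooth, v, w, ?_⟩
  ext x
  change w (algebraMap (MvPolynomial (Fin n) A) (Localization.Away t)
    (algebraMap A (MvPolynomial (Fin n) A) x)) = φ x
  rw [MvPolynomial.algebraMap_eq, hw_def, IsLocalization.coe_liftAlgHom, IsLocalization.lift_eq,
    hψ_def]
  exact aevalTower_C _ _ _

/-- **Stacks 07EU in terms of `𝔥_A`**: if `𝔥_A = Λ` then `A → Λ` factors through a smooth
`R`-algebra (the base case of the Noetherian induction in the proof of 07GC).
[cite: StacksProject, Tag 07EU] -/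
theorem factorsThroughSmooth_of_hIdeal_eq_top {R A Λ : Type u} [CommRing R] [CommRing A]
    [Algebra R A] [Algebra.FinitePresentation R A] [CommRing Λ] [Algebra R Λ] (φ : A →ₐ[R] Λ)
    (h : hIdeal R φ = ⊤) : FactorsThroughSmooth R φ :=
  factorsThroughSmooth_of_map_singularIdeal_eq_top φ ((hIdeal_eq_top_iff φ).mp h)

end FinalSolve

end Literature.AlgebraicGeometry.Resolution

end
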